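import Summits.BirchSwinnertonDyer.BirchSwinnertonDyer.Theorems.KolyvaginRankRigidityAtTwoRegularValueEngineStepB
import Summits.BirchSwinnertonDyer.BirchSwinnertonDyer.Theorems.GenusKolyvaginAtTwoPowDvdShaCardAtTwoPosTRegularEigenCyclic
import HarnessLib

/-!
# Crux U1 `KolyvaginBoundedDefectAtTwo` (stmt-BirchSwinnertonDyer-28083), LINE 17 `regular_core_rigidity` v3,
# stub S1b `stub_nearCoreExistenceAtTwo` — (N5) THE VALUE ENGINE, part 2: regular Zhang–Kolyvagin primes at `2`
# with PRESCRIBED LOCAL VALUES on a `τ`-stable span (phantom-tolerant), END-TO-END on U1's frame, exported as exact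
# local orders of the basis and of arbitrary `ℤ`-combinations

Width seat `bsd-line-krr2-p2` g14 (ONE READER on S1b); `--supports stmt-BirchSwinnertonDyer-28083` (helper). THEOREMS
ONLY; nothing here proves S1b, U1, a rung or BSD. BSD is NOT proved.

Sequel to `…RegularValueEngineStepB` (§1–§3: joint surjectivity with restricted hypotheses, the value algebra,
McCallum's Galois element). THIS FILE:
* §4 `exists_galoisElement_values_rat` — ℚ-side packaging: `h₀ = c₀ · res ρ₀` a regular involution on `E(ℚ̄)[2^M]`
  (`2^n(P + h₀P) ≠ 0`, so `E[2^M] = ℤP ⊕ ℤ·h₀P` by gk2-p3's `free_of_regular`); output `ρ` with the same action and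
  `[c_i, (ρ m)^t (ρ m)] = e_K (α i • P + (Tm α) i • h₀P)` on `𝒩`.
* §5 `exists_regular_kolyvaginPrime_values_of_heegner` — END-TO-END on U1's frame binders (`K` imaginary quadratic,
  `d_K` odd, Heegner hypothesis for `N_E`, `ρ̄_{E,2}` and `ρ_{E,2^M}` onto) modulo only the tree's Čebotarev token
  (`Automorphic.chebotarev_artinRep`, a tree THEOREM `…_of_galoisSide`): ONE regular `μ`-inverting involution `h`, and
  beyond every bound a Zhang–Kolyvagin prime `ℓ` at `2` of index `≥ M`, whose Frobenius is `h` — so REGULAR at level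
  `2^M` in the words of LINE 17's stubs (`h² = 1`, `2^{M−1}(P + hP) ≠ 0`, clause included verbatim) — with the EXACT
  local orders `2^{Nb i}` of the basis classes and `2^{Nq j}` of any listed `ℤ`-combinations `∑_i a j i • c_i`, read
  off the integer pairs `(α, Tm α)` — the shape the tree's local dictionaries consume (`torsionLocalKer` membership of
  `2^N •` / `2^{N−1} •`; eigen-combinations `(1 ± τ)y` are the walk's use). In words: the localisation of the span at
  `λ` IS the chosen equivariant homomorphism `c_i ↦ α i • P + (Tm α) i • hP` into `H¹_f(K_λ, E[2^M]) ≅ E[2^M]`.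
References (locators only; no cited FACT is declared): [cite: McCallumLMS1991, §3 (2), Prop. 3.1, Cor. 3.2]
[cite: GrossLMS1991, §3 (3.1)–(3.3), §9 Prop. 9.3] [cite: MazurRubin2004, §2.4 (H.2), §4.1]
[cite: WZhang2014, Notations (xii)].
Design: no definitions; `K : Type u` as in the engine files; axioms `propext`, `Classical.choice`, `Quot.sound`.
-/

set_option linter.dupNamespace false -- tree convention: `Summit.BirchSwinnertonDyer.BirchSwinnertonDyer.Theorems`
set_option autoImplicit false

noncomputable section

namespace Summit.BirchSwinnertonDyer.BirchSwinnertonDyer.Theorems.KolyvaginAtTwo.RegularValueEngine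

open scoped Classical
open WeierstrassCurve Field Finset
open Literature.NumberTheory.EllipticCurves
open Summit.BirchSwinnertonDyer.BirchSwinnertonDyer.Theorems.GenusExact

universe u v


/-! ### §4 ℚ-side packaging: `h₀ = c₀ · res ρ₀` regular, `E[2^M] = ℤP ⊕ ℤ·h₀P` -/

section StepBRat

open scoped Pointwise
open NumberField Literature.NumberTheory.GaloisRepresentations Literature.NumberTheory
open Summit.BirchSwinnertonDyer.BirchSwinnertonDyer.Theorems.OffBigImageOddLocalAtTwo.Engine
open Summit.BirchSwinnertonDyer.BirchSwinnertonDyer.Theorems.GenusExact.RegularPlusDescent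

variable {W : WeierstrassCurve ℚ} {K : Type u} [Field K] [NumberField K]

/-- A combination of combinations of `P`, `Q`. [folklore] -/
theorem sum_zsmul_comb {T : Type*} [AddCommGroup T] {ι : Type*} (s : Finset ι) (c a b : ι → ℤ) (P Q : T) :
    ∑ j ∈ s, c j • (a j • P + b j • Q) = (∑ j ∈ s, c j * a j) • P + (∑ j ∈ s, c j * b j) • Q := by
  simp_rw [smul_add, smul_smul, Finset.sum_add_distrib, Finset.sum_smul]

/-- **Step B with VALUES for a REGULAR element, ℚ-side packaging.** `K` imaginary quadratic, `c₀` a complex conjugation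
with transport lifting `c ≠ 1`, `M = n + 1`; `ρ₀ ∈ Γ_K` with `h₀ := c₀ · res ρ₀` an involution on `E(ℚ̄)[2^M]` (`hsq`) and
`2^n (P + h₀P) ≠ 0` (`hP1`, so `E[2^M] = ℤP ⊕ ℤ·h₀P` by gk2-p3's `free_of_regular`); a family `cs` spanning a
`τ`-stable subgroup (matrix `Tm` on `Γ_{K(E[2^M])}`), exponents/independence of the RESTRICTIONS, and a character `α`
(`2^M ∣ 2^{e i} α i`). Then some `ρ ∈ Γ_K` with the SAME action `c₀ · res ρ = h₀` on `E(ℚ̄)[2^M]` has, for all `m ∈ 𝒩`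
and all `i`, `[c_i, (ρ m)^t (ρ m)] = e_K (α i • P + (∑_j Tm i j α j) • h₀P)` (`e_K : E(ℚ̄)[2^M] ≃ E(K̄)[2^M]` the tree's
`RatClosure.torsionEquiv`). [cite: McCallumLMS1991, §3 (2), Prop. 3.1] [cite: GrossLMS1991, §9 Prop. 9.3] -/
theorem exists_galoisElement_values_rat [W.IsElliptic] (hK : IsImaginaryQuadratic K) (n : ℕ)
    {c₀ : absoluteGaloisGroup ℚ} (hc₀ : IsComplexConjugation (Rat.castHom ℝ) c₀)
    {c : K ≃ₐ[ℚ] K} (hc : c ≠ 1)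
    (hS : ∀ H : AddSubgroup (geomTorsion (W.baseChange K) 2),
      (∀ g : absoluteGaloisGroup K, ∀ t ∈ H, g • t ∈ H) → H = ⊥ ∨ H = ⊤)
    (hC : ∀ f : geomTorsion (W.baseChange K) 2 →+ geomTorsion (W.baseChange K) 2,
      (∀ (g : absoluteGaloisGroup K) (t : geomTorsion (W.baseChange K) 2), f (g • t) = g • f t) →
        ∃ c : ℤ, ∀ t, f t = c • t)
    (ρ₀ : absoluteGaloisGroup K)
    (hsq : ∀ X : geomTorsion W ((2 ^ (n + 1) : ℕ) : ℤ),
      (c₀ * absGaloisRestrict ℚ K ρ₀) • (c₀ * absGaloisRestrict ℚ K ρ₀) • X = X)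
    {P : geomTorsion W ((2 ^ (n + 1) : ℕ) : ℤ)}
    (hP1 : (2 : ℤ) ^ n • (P + (c₀ * absGaloisRestrict ℚ K ρ₀) • P) ≠ 0)
    {ι : Type*} [Fintype ι] {cs : ι → galH1Torsion (W.baseChange K) ((2 ^ (n + 1) : ℕ) : ℤ)} (Tm : ι → ι → ℤ)
    (hT : ∀ i, ∀ ρ ∈ torsionFixing (W.baseChange K) ((2 ^ (n + 1) : ℕ) : ℤ),
      h1Eval (W.baseChange K) ((2 ^ (n + 1) : ℕ) : ℤ) (conjAct W c ((2 ^ (n + 1) : ℕ) : ℤ) (cs i)) ρ =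
        h1Eval (W.baseChange K) ((2 ^ (n + 1) : ℕ) : ℤ) (∑ j, Tm i j • cs j) ρ)
    (e : ι → ℕ)
    (he : ∀ i, ∀ ρ ∈ torsionFixing (W.baseChange K) ((2 ^ (n + 1) : ℕ) : ℤ),
      (2 : ℤ) ^ e i • h1Eval (W.baseChange K) ((2 ^ (n + 1) : ℕ) : ℤ) (cs i) ρ = 0)
    (hind : ∀ a : ι → ℤ, (∀ ρ ∈ torsionFixing (W.baseChange K) ((2 ^ (n + 1) : ℕ) : ℤ),
      h1Eval (W.baseChange K) ((2 ^ (n + 1) : ℕ) : ℤ) (∑ i, a i • cs i) ρ = 0) → ∀ i, (2 : ℤ) ^ e i ∣ a i)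
    (α : ι → ℤ) (hα : ∀ i, (2 : ℤ) ^ (n + 1) ∣ 2 ^ e i * α i) :
    ∃ ρ : absoluteGaloisGroup K,
      (∀ X : geomTorsion W ((2 ^ (n + 1) : ℕ) : ℤ),
        (c₀ * absGaloisRestrict ℚ K ρ) • X = (c₀ * absGaloisRestrict ℚ K ρ₀) • X) ∧
      (∀ X : geomTorsion W ((2 ^ (n + 1) : ℕ) : ℤ),
        (c₀ * absGaloisRestrict ℚ K ρ) • (c₀ * absGaloisRestrict ℚ K ρ) • X = X) ∧
      ∀ m ∈ evalKer (W.baseChange K) ((2 ^ (n + 1) : ℕ) : ℤ) cs, ∀ i,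
        h1Eval (W.baseChange K) ((2 ^ (n + 1) : ℕ) : ℤ) (cs i)
            ((RatClosure.isLiftOfAut_absGaloisTransport_of_isImaginaryQuadratic hK hc hc₀).conjGalCMH
              (ρ * m) * (ρ * m)) =
          RatClosure.torsionEquiv (K := K) W ((2 ^ (n + 1) : ℕ) : ℤ)
            (α i • P + (∑ j, Tm i j * α j) • ((c₀ * absGaloisRestrict ℚ K ρ₀) • P)) := by
  classical
  have h2n : (2 : ℤ) ∣ ((2 ^ (n + 1) : ℕ) : ℤ) := by
    rw [Nat.cast_pow]; exact dvd_pow_self _ (by omega)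
  set t : AlgebraicClosure K ≃+* AlgebraicClosure K :=
    (absGaloisTransport (K := ℚ) (L := K) c₀).toRingEquiv with ht_def
  have ht : IsLiftOfAut c t :=
    RatClosure.isLiftOfAut_absGaloisTransport_of_isImaginaryQuadratic hK hc hc₀
  have hinv : ∀ x, t (t x) = x := fun x ↦
    RatClosure.absGaloisTransport_absGaloisTransport_of_sq_eq_one hc₀.sq_eq_one x
  have hk₀ : ht.conjGalCMH ρ₀ * ρ₀ ∈ torsionFixing (W.baseChange K) ((2 ^ (n + 1) : ℕ) : ℤ) :=
    conjGal_mul_mem_torsionFixing_of_smul_smul hc₀ ht ρ₀ hsq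
  set eq := RatClosure.torsionEquiv (K := K) W ((2 ^ (n + 1) : ℕ) : ℤ) with heq
  -- the transport of `h₀`: `eq (h₀ X) = ρ₀⁻¹ • τ (eq X)`
  have hB : ∀ X : geomTorsion W ((2 ^ (n + 1) : ℕ) : ℤ), eq ((c₀ * absGaloisRestrict ℚ K ρ₀) • X) =
      ρ₀⁻¹ • ht.torsionMap W ((2 ^ (n + 1) : ℕ) : ℤ) (eq X) := fun X ↦ by
    rw [mul_smul, heq, RatClosure.torsionEquiv_smul_of_lift W ht c₀ (fun _ ↦ rfl),
      RatClosure.torsionEquiv_smul, inv_smul_torsionMap_eq_of_conjGal_mul_mem W ht hinv ρ₀ hk₀]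
  -- `E[2^M] = ℤP ⊕ ℤ h₀P` on the `ℚ`-side (gk2-p3), transported
  obtain ⟨hfreeQ, hgenQ⟩ := free_of_regular W n P hP1
  have hPn : ((2 ^ (n + 1) : ℕ) : ℤ) • P = 0 :=
    Subtype.ext ((mem_geomTorsion_iff W _ (P : geomPoints W)).mp P.2)
  have hcast : ((2 ^ (n + 1) : ℕ) : ℤ) = (2 : ℤ) ^ (n + 1) := by push_cast; rfl
  have hPM : (2 : ℤ) ^ (n + 1) • eq P = 0 := by rw [← hcast, ← map_zsmul, hPn, map_zero]
  have hgen : ∀ Q : geomTorsion (W.baseChange K) ((2 ^ (n + 1) : ℕ) : ℤ), ∃ a b : ℤ,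
      Q = a • eq P + b • (ρ₀⁻¹ • ht.torsionMap W ((2 ^ (n + 1) : ℕ) : ℤ) (eq P)) := fun Q ↦ by
    obtain ⟨a, b, hab⟩ := hgenQ (eq.symm Q)
    refine ⟨a, b, ?_⟩
    rw [← hB, ← map_zsmul, ← map_zsmul, ← map_add, ← hab, AddEquiv.apply_symm_apply]
  have hfree : ∀ a b : ℤ, a • eq P + b • (ρ₀⁻¹ • ht.torsionMap W ((2 ^ (n + 1) : ℕ) : ℤ) (eq P)) = 0 →
      (2 : ℤ) ^ (n + 1) ∣ a ∧ (2 : ℤ) ^ (n + 1) ∣ b := fun a b hab ↦ by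
    rw [← hB, ← map_zsmul, ← map_zsmul, ← map_add, map_eq_zero_iff _ eq.injective] at hab
    have h := hfreeQ a b hab
    rwa [hcast] at h
  obtain ⟨nn, hnn, H⟩ := exists_h1Eval_conj_mul_eq_regular W ht hinv h2n hS hC ρ₀ hk₀ hPM hgen hfree Tm hT e
    he hind α hα
  refine ⟨ρ₀ * nn, fun X ↦ mul_absGaloisRestrict_mul_smul_eq c₀ hnn X, fun X ↦ ?_, fun m hm i ↦ ?_⟩
  · rw [mul_absGaloisRestrict_mul_smul_eq c₀ hnn, mul_absGaloisRestrict_mul_smul_eq c₀ hnn, hsq]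
  · rw [H m hm i, map_add, map_zsmul, map_zsmul, hB]

end StepBRat

/-! ### §5 End-to-end on U1's frame: ONE regular `h`, and beyond every bound a regular Zhang–Kolyvagin prime at `2`
with the prescribed local values, exported as exact local orders of the basis and of the listed combinations -/

section EndToEnd

open scoped Pointwise
open NumberField IsDedekindDomain Literature.NumberTheory.GaloisRepresentations Literature.NumberTheory
open Rat.HeightOneSpectrum
open Summit.BirchSwinnertonDyer.BirchSwinnertonDyer.Theorems.OffBigImageOddLocalAtTwo.Engine
open Summit.BirchSwinnertonDyer.BirchSwinnertonDyer.Theorems.GenusExact.RegularPlusDescent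

/-- The evaluation kernel of an appended family lies in that of its first part. [folklore] -/
theorem evalKer_append_le {k' : Type v} [Field k'] (V : WeierstrassCurve k') (n : ℤ) {r q : ℕ}
    (xs : Fin r → galH1Torsion V n) (ys : Fin q → galH1Torsion V n) :
    evalKer V n (Fin.append xs ys) ≤ evalKer V n xs := by
  intro m hm
  refine ⟨hm.1, fun i ↦ ?_⟩
  have h := hm.2 (Fin.castAdd q i)
  rwa [Fin.append_left] at h

/-- Exact order `2^N` of `u • P + w • Q` on a pair `(P, Q)` free over `ℤ/2^M`, read off the integers `u, w`.
[folklore] -/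
theorem zsmul_comb_order {T : Type*} [AddCommGroup T] {M : ℕ} {P Q : T}
    (hPM : (2 : ℤ) ^ M • P = 0) (hQM : (2 : ℤ) ^ M • Q = 0)
    (hfree : ∀ a b : ℤ, a • P + b • Q = 0 → (2 : ℤ) ^ M ∣ a ∧ (2 : ℤ) ^ M ∣ b)
    {u w : ℤ} {N : ℕ}
    (hN : (2 : ℤ) ^ M ∣ 2 ^ N * u ∧ (2 : ℤ) ^ M ∣ 2 ^ N * w ∧
      (N ≠ 0 → ¬ ((2 : ℤ) ^ M ∣ 2 ^ (N - 1) * u ∧ (2 : ℤ) ^ M ∣ 2 ^ (N - 1) * w))) :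
    (2 : ℤ) ^ N • (u • P + w • Q) = 0 ∧ (N ≠ 0 → (2 : ℤ) ^ (N - 1) • (u • P + w • Q) ≠ 0) := by
  refine ⟨?_, fun hN0 h ↦ hN.2.2 hN0 ?_⟩
  · rw [smul_add, smul_smul, smul_smul, zsmul_eq_zero_of_dvd hPM hN.1, zsmul_eq_zero_of_dvd hQM hN.2.1,
      add_zero]
  · rw [smul_add, smul_smul, smul_smul] at h
    exact hfree _ _ h

variable {W : WeierstrassCurve ℚ} {K : Type u} [Field K] [NumberField K]

/-- **THE VALUE ENGINE, END-TO-END (U1's frame binders; phantom-tolerant; `τ`-stable span).** `E/ℚ` globally minimal,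
`K` imaginary quadratic with `d_K` odd and the Heegner hypothesis for `N_E`, `ρ̄_{E,2}` and `ρ_{E,2^M}` onto (`M = n+1`),
`c₀` a complex conjugation, `c ≠ 1` in `Gal(K/ℚ)`. DATA: classes `c_i ∈ H¹(K, E[2^M])` (`i < r`) whose span is
`τ`-stable on `Γ_{K(E[2^M])}` through the integer matrix `Tm` (`hT`), with exponents `e i` and independence of their
RESTRICTIONS to `Γ_{K(E[2^M])}` (`he`, `hind` — classes meeting the inflation kernel allowed), a CHARACTER `α`
(`2^M ∣ 2^{e i} α i`), and finitely many `ℤ`-combinations `∑_i a j i • c_i`; the exponents `Nb i`, `Nq j` are the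
exact orders, in `(ℤ/2^M)²`, of the integer pairs `(α i, (Tm α) i)` and `(∑ a α, ∑ a (Tm α))` (`hNb`, `hNq`). THEN:
one `ρ ∈ Γ_K` with `h := c₀ · res ρ` a `μ_{2^M}`-inverting REGULAR involution on `E(ℚ̄)[2^M]` (lossless:
`2^n(P + hP) ≠ 0`, `ker(h − 1) = im(h + 1)` on each `E[2^k]`), and for every bound `b` a prime `ℓ > b` that is a
Zhang–Kolyvagin prime at `2` of index `≥ M` (`M ≤ M(ℓ)`), whose arithmetic Frobenius is `h` on `E[2^M]` and `c₀` on `K`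
— so REGULAR at level `2^M` in the words of LINE 17's stubs (`h² = 1`, `2^{M−1}(P + hP) ≠ 0`) — and at `λ ∋ ℓ` the
classes `c_i` and the combinations have EXACTLY the local orders `2^{Nb i}`, `2^{Nq j}`: the localisation of the span
IS the equivariant homomorphism `c_i ↦ α i • P + (Tm α) i • hP` into `H¹_f(K_λ, E[2^M]) ≅ E[2^M]`. Conditional only
on the displayed tree theorem-token `hCheb : Automorphic.chebotarev_artinRep`.
[cite: McCallumLMS1991, §3 (2), Prop. 3.1, Cor. 3.2] [cite: GrossLMS1991, §3 (3.1)–(3.3), §9 Prop. 9.3]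
[cite: MazurRubin2004, §2.4 (H.2), §4.1] [cite: WZhang2014, Notations (xii)] -/
theorem exists_regular_kolyvaginPrime_values_of_heegner (hCheb : Automorphic.chebotarev_artinRep) {N : ℕ}
    [NeZero N] [W.IsElliptic] [W.IsGloballyMinimal] (hK : IsImaginaryQuadratic K)
    (hodd : Odd (NumberField.discr K)) (hH : SatisfiesHeegnerHypothesis (W.conductorNorm ℤ) K) (n : ℕ)
    (hρ2 : W.HasSurjectiveModNGaloisRep 2) (hsurj : W.HasSurjectiveModNGaloisRep ((2 ^ (n + 1) : ℕ) : ℤ))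
    {c₀ : absoluteGaloisGroup ℚ} (hc₀ : IsComplexConjugation (Rat.castHom ℝ) c₀)
    {c : K ≃ₐ[ℚ] K} (hc : c ≠ 1)
    {r : ℕ} (cs : Fin r → galH1Torsion (W.baseChange K) ((2 ^ (n + 1) : ℕ) : ℤ)) (Tm : Fin r → Fin r → ℤ)
    (hT : ∀ i, ∀ ρ ∈ torsionFixing (W.baseChange K) ((2 ^ (n + 1) : ℕ) : ℤ),
      h1Eval (W.baseChange K) ((2 ^ (n + 1) : ℕ) : ℤ) (conjAct W c ((2 ^ (n + 1) : ℕ) : ℤ) (cs i)) ρ =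
        h1Eval (W.baseChange K) ((2 ^ (n + 1) : ℕ) : ℤ) (∑ j, Tm i j • cs j) ρ)
    (e : Fin r → ℕ)
    (he : ∀ i, ∀ ρ ∈ torsionFixing (W.baseChange K) ((2 ^ (n + 1) : ℕ) : ℤ),
      (2 : ℤ) ^ e i • h1Eval (W.baseChange K) ((2 ^ (n + 1) : ℕ) : ℤ) (cs i) ρ = 0)
    (hind : ∀ a : Fin r → ℤ, (∀ ρ ∈ torsionFixing (W.baseChange K) ((2 ^ (n + 1) : ℕ) : ℤ),
      h1Eval (W.baseChange K) ((2 ^ (n + 1) : ℕ) : ℤ) (∑ i, a i • cs i) ρ = 0) → ∀ i, (2 : ℤ) ^ e i ∣ a i)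
    (α : Fin r → ℤ) (hα : ∀ i, (2 : ℤ) ^ (n + 1) ∣ 2 ^ e i * α i)
    (Nb : Fin r → ℕ)
    (hNb : ∀ i, (2 : ℤ) ^ (n + 1) ∣ 2 ^ Nb i * α i ∧ (2 : ℤ) ^ (n + 1) ∣ 2 ^ Nb i * ∑ j, Tm i j * α j ∧
      (Nb i ≠ 0 → ¬ ((2 : ℤ) ^ (n + 1) ∣ 2 ^ (Nb i - 1) * α i ∧
        (2 : ℤ) ^ (n + 1) ∣ 2 ^ (Nb i - 1) * ∑ j, Tm i j * α j)))
    {q : ℕ} (a : Fin q → Fin r → ℤ) (Nq : Fin q → ℕ)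
    (hNq : ∀ j', (2 : ℤ) ^ (n + 1) ∣ 2 ^ Nq j' * ∑ i, a j' i * α i ∧
      (2 : ℤ) ^ (n + 1) ∣ 2 ^ Nq j' * ∑ i, a j' i * ∑ j, Tm i j * α j ∧
      (Nq j' ≠ 0 → ¬ ((2 : ℤ) ^ (n + 1) ∣ 2 ^ (Nq j' - 1) * ∑ i, a j' i * α i ∧
        (2 : ℤ) ^ (n + 1) ∣ 2 ^ (Nq j' - 1) * ∑ i, a j' i * ∑ j, Tm i j * α j)))
    : ∃ ρ : absoluteGaloisGroup K,
      (∀ X : geomTorsion W ((2 ^ (n + 1) : ℕ) : ℤ),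
        (c₀ * absGaloisRestrict ℚ K ρ) • (c₀ * absGaloisRestrict ℚ K ρ) • X = X) ∧
      (∀ ζ : AlgebraicClosure ℚ, ζ ^ (2 ^ (n + 1)) = 1 → (c₀ * absGaloisRestrict ℚ K ρ) • ζ = ζ⁻¹) ∧
      (∃ P : geomTorsion W ((2 ^ (n + 1) : ℕ) : ℤ),
        (2 : ℤ) ^ n • (P + (c₀ * absGaloisRestrict ℚ K ρ) • P) ≠ 0) ∧
      (∀ (k : ℕ) (X : geomTorsion W ((2 ^ (n + 1) : ℕ) : ℤ)), (2 : ℤ) ^ k • X = 0 →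
          (c₀ * absGaloisRestrict ℚ K ρ) • X = X →
          ∃ Y : geomTorsion W ((2 ^ (n + 1) : ℕ) : ℤ),
            (2 : ℤ) ^ k • Y = 0 ∧ X = Y + (c₀ * absGaloisRestrict ℚ K ρ) • Y) ∧
      ∀ b : ℕ, ∃ ℓ : ℕ, b < ℓ ∧ Zhang2014.IsKolyvaginPrime N W K 2 ℓ ∧
        n + 1 ≤ Zhang2014.kolyvaginIndex W 2 ℓ ∧ ((n + 1 : ℕ) : ℕ∞) ≤ Zhang2014.levelIndex W 2 ℓ ∧
        (∃ (v : HeightOneSpectrum (𝓞 ℚ)) (𝔓 : Ideal (absIntegers (𝓞 ℚ) ℚ)) (h : absoluteGaloisGroup ℚ),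
          (ℓ : 𝓞 ℚ) ∈ v.asIdeal ∧ 𝔓 ∈ v.primesAbove ∧ IsArithFrobAt (𝓞 ℚ) h 𝔓 ∧
          (∀ P : geomTorsion W ((2 ^ (n + 1) : ℕ) : ℤ), h • P = (c₀ * absGaloisRestrict ℚ K ρ) • P) ∧
          (∀ (e : K →ₐ[ℚ] AlgebraicClosure ℚ) (x : K), h • e x = c₀ • e x) ∧
          (∀ X : geomTorsion W ((2 ^ (n + 1) : ℕ) : ℤ), h • h • X = X) ∧
          ∃ P : geomTorsion W ((2 ^ (n + 1) : ℕ) : ℤ), (2 : ℤ) ^ (n + 1 - 1) • (P + h • P) ≠ 0) ∧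
        (∀ i, ∀ v : HeightOneSpectrum (𝓞 K), (ℓ : 𝓞 K) ∈ v.asIdeal →
          (((2 : ℤ) ^ Nb i) • cs i ∈
              (W.baseChange K).torsionLocalKer (v.adicCompletion K) ((2 ^ (n + 1) : ℕ) : ℤ) ∧
            (Nb i ≠ 0 → ((2 : ℤ) ^ (Nb i - 1)) • cs i ∉
              (W.baseChange K).torsionLocalKer (v.adicCompletion K) ((2 ^ (n + 1) : ℕ) : ℤ)))) ∧
        (∀ j', ∀ v : HeightOneSpectrum (𝓞 K), (ℓ : 𝓞 K) ∈ v.asIdeal →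
          (((2 : ℤ) ^ Nq j') • (∑ i, a j' i • cs i) ∈
              (W.baseChange K).torsionLocalKer (v.adicCompletion K) ((2 ^ (n + 1) : ℕ) : ℤ) ∧
            (Nq j' ≠ 0 → ((2 : ℤ) ^ (Nq j' - 1)) • (∑ i, a j' i • cs i) ∉
              (W.baseChange K).torsionLocalKer (v.adicCompletion K) ((2 ^ (n + 1) : ℕ) : ℤ)))) := by
  classical
  obtain ⟨hS, hC⟩ := imageTokens_two_of_heegner (W := W) hK hodd hH hρ2
  obtain ⟨ρ₀, P, hsq, hP1, hker, hμ'⟩ := exists_regular_galoisElement_of_supply (K := K) n c₀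
    (fun A ↦ exists_mul_absGaloisRestrict_smul_eq_addAut_of_heegner hK hodd hH hsurj c₀ A)
  obtain ⟨ρ, hact, hsqρ, hval⟩ := exists_galoisElement_values_rat (W := W) hK n hc₀ hc hS hC ρ₀ hsq hP1
    (cs := cs) Tm hT e he hind α hα
  have hμ : ∀ ζ : AlgebraicClosure ℚ, ζ ^ (2 ^ (n + 1)) = 1 →
      (c₀ * absGaloisRestrict ℚ K ρ) • ζ = ζ⁻¹ := hμ' _ hact
  have hker' : ∀ (k : ℕ) (X : geomTorsion W ((2 ^ (n + 1) : ℕ) : ℤ)), (2 : ℤ) ^ k • X = 0 →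
      (c₀ * absGaloisRestrict ℚ K ρ) • X = X →
      ∃ Y : geomTorsion W ((2 ^ (n + 1) : ℕ) : ℤ),
        (2 : ℤ) ^ k • Y = 0 ∧ X = Y + (c₀ * absGaloisRestrict ℚ K ρ) • Y := fun k X h1 h2 ↦ by
    rw [hact] at h2
    obtain ⟨Y, hY, hXY⟩ := hker k X h1 h2
    exact ⟨Y, hY, by rw [hact]; exact hXY⟩
  -- the transport and the lift (as in §4)
  set t : AlgebraicClosure K ≃+* AlgebraicClosure K :=
    (absGaloisTransport (K := ℚ) (L := K) c₀).toRingEquiv with ht_def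
  have ht : IsLiftOfAut c t :=
    RatClosure.isLiftOfAut_absGaloisTransport_of_isImaginaryQuadratic hK hc hc₀
  set eq := RatClosure.torsionEquiv (K := K) W ((2 ^ (n + 1) : ℕ) : ℤ) with heq
  -- the free pair `(P, h₀P)` and its orders
  set hP : geomTorsion W ((2 ^ (n + 1) : ℕ) : ℤ) := (c₀ * absGaloisRestrict ℚ K ρ₀) • P with hhPdef
  obtain ⟨hfreeQ, -⟩ := free_of_regular W n P hP1
  have hcast : ((2 ^ (n + 1) : ℕ) : ℤ) = (2 : ℤ) ^ (n + 1) := by push_cast; rfl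
  have hPn : (2 : ℤ) ^ (n + 1) • P = 0 := by
    rw [← hcast]; exact Subtype.ext ((mem_geomTorsion_iff W _ (P : geomPoints W)).mp P.2)
  have hhPn : (2 : ℤ) ^ (n + 1) • hP = 0 := by rw [hhPdef, smul_comm, hPn, smul_zero]
  have hfree' : ∀ u w : ℤ, u • P + w • hP = 0 → (2 : ℤ) ^ (n + 1) ∣ u ∧ (2 : ℤ) ^ (n + 1) ∣ w :=
    fun u w huw ↦ by have h := hfreeQ u w huw; rwa [hcast] at h
  -- the export family: basis followed by the combinations
  set ys : Fin (r + q) → galH1Torsion (W.baseChange K) ((2 ^ (n + 1) : ℕ) : ℤ) :=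
    Fin.append cs (fun j' ↦ ∑ i, a j' i • cs i) with hys
  set Nv : Fin (r + q) → ℕ := Fin.append Nb Nq with hNv
  have hρ : ∀ m ∈ evalKer (W.baseChange K) ((2 ^ (n + 1) : ℕ) : ℤ) ys, ∀ idx,
      ((2 : ℤ) ^ Nv idx) • h1Eval (W.baseChange K) ((2 ^ (n + 1) : ℕ) : ℤ) (ys idx)
          (ht.conjGalCMH (ρ * m) * (ρ * m)) = 0 ∧
        (Nv idx ≠ 0 → ((2 : ℤ) ^ (Nv idx - 1)) • h1Eval (W.baseChange K) ((2 ^ (n + 1) : ℕ) : ℤ) (ys idx)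
          (ht.conjGalCMH (ρ * m) * (ρ * m)) ≠ 0) := by
    intro m hm
    have hm' : m ∈ evalKer (W.baseChange K) ((2 ^ (n + 1) : ℕ) : ℤ) cs := evalKer_append_le _ _ cs _ hm
    have hsqm : ∀ X : geomTorsion W ((2 ^ (n + 1) : ℕ) : ℤ),
        (c₀ * absGaloisRestrict ℚ K (ρ * m)) • (c₀ * absGaloisRestrict ℚ K (ρ * m)) • X = X := fun X ↦ by
      rw [mul_absGaloisRestrict_mul_smul_eq c₀ hm'.1, mul_absGaloisRestrict_mul_smul_eq c₀ hm'.1, hsqρ]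
    have hg : ht.conjGalCMH (ρ * m) * (ρ * m) ∈ torsionFixing (W.baseChange K) ((2 ^ (n + 1) : ℕ) : ℤ) :=
      conjGal_mul_mem_torsionFixing_of_smul_smul hc₀ ht (ρ * m) hsqm
    -- transport of exact orders through `eq`
    have htrans : ∀ (u w : ℤ) (N' : ℕ),
        ((2 : ℤ) ^ (n + 1) ∣ 2 ^ N' * u ∧ (2 : ℤ) ^ (n + 1) ∣ 2 ^ N' * w ∧
          (N' ≠ 0 → ¬ ((2 : ℤ) ^ (n + 1) ∣ 2 ^ (N' - 1) * u ∧ (2 : ℤ) ^ (n + 1) ∣ 2 ^ (N' - 1) * w))) →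
        (2 : ℤ) ^ N' • eq (u • P + w • hP) = 0 ∧ (N' ≠ 0 → (2 : ℤ) ^ (N' - 1) • eq (u • P + w • hP) ≠ 0) := by
      intro u w N' hN'
      obtain ⟨h0, h1⟩ := zsmul_comb_order hPn hhPn hfree' hN'
      refine ⟨by rw [← map_zsmul, h0, map_zero], fun hN0 h ↦ h1 hN0 ?_⟩
      rw [← map_zsmul, map_eq_zero_iff _ eq.injective] at h
      exact h
    refine Fin.addCases (fun i ↦ ?_) (fun j' ↦ ?_)
    · have hy : ys (Fin.castAdd q i) = cs i := by rw [hys, Fin.append_left]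
      have hN : Nv (Fin.castAdd q i) = Nb i := by rw [hNv, Fin.append_left]
      rw [hy, hN, hval m hm' i]
      exact htrans _ _ _ (hNb i)
    · have hy : ys (Fin.natAdd r j') = ∑ i, a j' i • cs i := by rw [hys, Fin.append_right]
      have hN : Nv (Fin.natAdd r j') = Nq j' := by rw [hNv, Fin.append_right]
      have hsumval : h1Eval (W.baseChange K) ((2 ^ (n + 1) : ℕ) : ℤ) (∑ i, a j' i • cs i)
          (ht.conjGalCMH (ρ * m) * (ρ * m)) =
          eq ((∑ i, a j' i * α i) • P + (∑ i, a j' i * ∑ j, Tm i j * α j) • hP) := by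
        rw [h1Eval_sum _ _ _ _ hg]
        simp only [h1Eval_zsmul _ _ _ _ hg, hval m hm']
        rw [← sum_zsmul_comb, map_sum]
        simp only [map_zsmul]
      rw [hy, hN, hsumval]
      exact htrans _ _ _ (hNq j')
  refine ⟨ρ, hsqρ, hμ, ⟨P, by rw [hact]; exact hP1⟩, hker', fun b ↦ ?_⟩
  obtain ⟨ℓ, hb, hℓp, hℓN, hℓd, hℓ2, hℓP, hfrob, hℓ1, hℓa, hloc⟩ :=
    exists_kolyvaginPrime_gt_two_of_galoisElement_regular (N := N) hCheb hK (M := n + 1) (by omega) hc₀ hc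
      ys Nv hsqρ hμ hρ b
  obtain ⟨hZ, hidx, hlev⟩ :=
    zhang_isKolyvaginPrime_two_of_regular (W := W) (K := K) (N := N) hℓp hℓN hℓd hℓ2 hℓP hℓ1 hℓa
  obtain ⟨v, 𝔓, h, hv, h𝔓, hh, hhP, hhK⟩ := hfrob
  refine ⟨ℓ, hb, hZ, hidx, hlev, ⟨v, 𝔓, h, hv, h𝔓, hh, hhP, hhK, fun X ↦ ?_, P, ?_⟩,
    fun i w hw ↦ ?_, fun j' w hw ↦ ?_⟩
  · rw [hhP, hhP, hsqρ]
  · rw [Nat.add_sub_cancel, hhP, hact]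
    exact hP1
  · have h1 := hloc (Fin.castAdd q i) w hw
    have hy : ys (Fin.castAdd q i) = cs i := by rw [hys, Fin.append_left]
    have hN : Nv (Fin.castAdd q i) = Nb i := by rw [hNv, Fin.append_left]
    rwa [hy, hN] at h1
  · have h1 := hloc (Fin.natAdd r j') w hw
    have hy : ys (Fin.natAdd r j') = ∑ i, a j' i • cs i := by rw [hys, Fin.append_right]
    have hN : Nv (Fin.natAdd r j') = Nq j' := by rw [hNv, Fin.append_right]
    rwa [hy, hN] at h1

end EndToEnd

end Summit.BirchSwinnertonDyer.BirchSwinnertonDyer.Theorems.KolyvaginAtTwo.RegularValueEngine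

end
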